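import Literature.NumberTheory.CubicFields.DavenportBoundNegFibers
import Literature.NumberTheory.CubicFields.DavenportBoundPosPairs
import HarnessLib

/-!
# Davenport's bound, negative discriminant: the `(d, c)`-count for fixed `(a, b)`

`Proofs` file (theorems only), topic `Literature/NumberTheory/CubicFields`, continuing
`DavenportBoundNegFibers.lean`.  For fixed `a ≥ 1` and `b`, the Mathews-reduced forms `(a, b, c, d)` with
`−Disc < X` (in root coordinates `(θ, u, v)`, `X = ξ¹²`, `a = α³`) are counted by summing the `c`-fibre
bounds over the admissible `d` (`0 < |d| ≤ (|b| + 2a)·M`, `M = ¼ + (bound for v²)`):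

* `ncard_dcFibre_neg_le_of_small` — `|b| < 2a`: `#{(d, c)} ≤ 88a²M + 16a²M²`, `M = ¼ + ξ⁴/α⁴`;
* `ncard_dcFibre_neg_le_of_large` — `|b| ≥ 2a`: `#{(d, c)} ≤ 24b²M + 128a²M²`,
  `M = ¼ + min(ξ⁴/α⁴, 64X/b⁴)`.

## References

* H. Davenport, *On the class-number of binary cubic forms II*, J. London Math. Soc. 26 (1951)
  192–198 [Davenport1951CubicFormsII].
-/

noncomputable section

namespace Literature.NumberTheory.CubicFields

namespace BinaryCubic

open Finset

/-! ### Nonzero integers of bounded size -/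

/-- `{d ≠ 0 : |d| ≤ R}` inside `[−⌊R⌋, ⌊R⌋] ∖ {0}`. [folklore] -/
theorem mem_Icc_filter_of_abs_le {d : ℤ} {R : ℝ} (hd : d ≠ 0) (h : |(d : ℝ)| ≤ R) :
    d ∈ (Finset.Icc (-⌊R⌋) ⌊R⌋).filter (· ≠ 0) := by
  rw [Finset.mem_filter, Finset.mem_Icc]
  have h' := abs_le.mp h
  refine ⟨⟨?_, Int.le_floor.mpr h'.2⟩, hd⟩
  have : -(d : ℝ) ≤ R := by linarith [h'.1]
  have h2 : (-d : ℤ) ≤ ⌊R⌋ := Int.le_floor.mpr (by push_cast; exact this)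
  omega

/-- `#([−⌊R⌋, ⌊R⌋] ∖ {0}) ≤ 2R` for `R ≥ 0`. [folklore] -/
theorem card_Icc_filter_ne_zero_le {R : ℝ} (hR : 0 ≤ R) :
    ((((Finset.Icc (-⌊R⌋) ⌊R⌋).filter (· ≠ 0)).card : ℕ) : ℝ) ≤ 2 * R := by
  have h0 : (0 : ℤ) ∈ Finset.Icc (-⌊R⌋) ⌊R⌋ := by
    rw [Finset.mem_Icc]; have := Int.floor_nonneg.mpr hR; omega
  rw [Finset.filter_ne', Finset.card_erase_of_mem h0, Int.card_Icc]
  have hfl : (0 : ℤ) ≤ ⌊R⌋ := Int.floor_nonneg.mpr hR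
  have h1 : (⌊R⌋ + 1 - -⌊R⌋).toNat = 2 * ⌊R⌋.toNat + 1 := by omega
  rw [h1]
  simp only [Nat.add_sub_cancel, Nat.cast_mul, Nat.cast_ofNat]
  have : ((⌊R⌋.toNat : ℕ) : ℝ) = ((⌊R⌋ : ℤ) : ℝ) := by
    rw [show ((⌊R⌋.toNat : ℕ) : ℝ) = (((⌊R⌋.toNat : ℕ) : ℤ) : ℝ) by push_cast; rfl,
      Int.toNat_of_nonneg hfl]
  rw [this]
  linarith [Int.floor_le R]

/-- Elements of `[−⌊R⌋, ⌊R⌋] ∖ {0}` have `|d| ≤ R`. [folklore] -/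
theorem abs_le_of_mem_Icc_filter {d : ℤ} {R : ℝ}
    (h : d ∈ (Finset.Icc (-⌊R⌋) ⌊R⌋).filter (· ≠ 0)) : |(d : ℝ)| ≤ R := by
  rw [Finset.mem_filter, Finset.mem_Icc] at h
  have h1 : ((⌊R⌋ : ℤ) : ℝ) ≤ R := Int.floor_le R
  have h2 : (d : ℝ) ≤ ⌊R⌋ := by exact_mod_cast h.1.2
  have h3 : (-⌊R⌋ : ℝ) ≤ d := by exact_mod_cast h.1.1
  rw [abs_le]; constructor <;> linarith

/-- A set of integers of diameter `≤ V` is finite. [folklore] -/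
theorem finite_of_diam {S : Set ℤ} {V : ℝ}
    (h : ∀ c₁ ∈ S, ∀ c₂ ∈ S, |((c₁ : ℤ) : ℝ) - c₂| ≤ V) : S.Finite := by
  rcases S.eq_empty_or_nonempty with hS | ⟨c₀, hc₀⟩
  · rw [hS]; exact Set.finite_empty
  · have hsub : S ⊆ {c : ℤ | (c₀ : ℝ) - V ≤ c ∧ (c : ℝ) ≤ c₀ + V} := by
      intro c hc
      have := abs_le.mp (h c hc c₀ hc₀)
      exact ⟨by linarith [this.1, this.2], by linarith [this.1, this.2]⟩
    have hfin : ({c : ℤ | (c₀ : ℝ) - V ≤ c ∧ (c : ℝ) ≤ c₀ + V}).Finite := by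
      rw [int_mem_Icc_eq]; exact Finset.finite_toSet _
    exact hfin.subset hsub

/-! ### Root-coordinate consequences with `X = ξ¹²`, `a = α³` -/

/-- `v² < ξ⁴/α⁴` (from `v⁶ < X/(4a⁴) < (ξ⁴/α⁴)³`). [folklore] -/
theorem v_sq_lt_xi {a θ u v X ξ α : ℝ} (ha : 1 ≤ a) (hX : 4 * a ^ 4 * ((θ - u) ^ 2 + v ^ 2) ^ 2 * v ^ 2 < X)
    (hξ : 0 < ξ) (hξX : ξ ^ 12 = X) (hα : 0 < α) (hαa : α ^ 3 = a) :
    v ^ 2 < ξ ^ 4 / α ^ 4 := by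
  have h6 := v_pow_six_lt (θ := θ) (u := u) ha hX
  have ha4 : 0 < 4 * a ^ 4 := by positivity
  have h1 : X / (4 * a ^ 4) ≤ (ξ ^ 4 / α ^ 4) ^ 3 := by
    rw [div_pow, ← hξX, ← hαa, div_le_div_iff₀ (by positivity) (by positivity)]
    ring_nf
    nlinarith [pow_pos hξ 12, pow_pos hα 12]
  refine lt_of_not_ge fun hcon => ?_
  have : (ξ ^ 4 / α ^ 4) ^ 3 ≤ (v ^ 2) ^ 3 := pow_le_pow_left₀ (by positivity) hcon 3
  nlinarith

/-! ### The `(d, c)`-count for fixed `(a, b)` -/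

/-- **`|b| < 2a`**: `#{(d, c) : (a, b, c, d) reduced, −Disc < X} ≤ 88a²M + 16a²M²` with `M = ¼ + ξ⁴/α⁴`
(`#{d} ≤ 2(|b| + 2a)M ≤ 8aM`, each `c`-fibre `≤ 2(2|b| + a + aM) + 1 ≤ 11a + 2aM`).
[cite: Davenport1951CubicFormsII, §3] -/
theorem ncard_dcFibre_neg_le_of_small (a b : ℤ) (ha : 1 ≤ a) (hb : |(b : ℝ)| < 2 * a)
    {X ξ α : ℝ} (hξ : 0 < ξ) (hξX : ξ ^ 12 = X) (hα : 0 < α) (hαa : α ^ 3 = a) (hαξ : α ≤ ξ) :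
    (({q : ℤ × ℤ | q.1 ≠ 0 ∧ ∃ θ u v : ℝ, 0 < v ∧ |u| ≤ 1 / 2 ∧ 1 ≤ u ^ 2 + v ^ 2 ∧
        (b : ℝ) = -a * (θ + 2 * u) ∧ (q.2 : ℝ) = a * (2 * θ * u + (u ^ 2 + v ^ 2)) ∧
        (q.1 : ℝ) = -a * (θ * (u ^ 2 + v ^ 2)) ∧
        4 * (a : ℝ) ^ 4 * ((θ - u) ^ 2 + v ^ 2) ^ 2 * v ^ 2 < X}).ncard : ℝ) ≤
      88 * (a : ℝ) ^ 2 * (1 / 4 + ξ ^ 4 / α ^ 4) + 16 * (a : ℝ) ^ 2 * (1 / 4 + ξ ^ 4 / α ^ 4) ^ 2 := by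
  classical
  set M : ℝ := 1 / 4 + ξ ^ 4 / α ^ 4 with hM
  have haR : (1 : ℝ) ≤ a := by exact_mod_cast ha
  have ha0 : (0 : ℝ) < a := by linarith
  have hM1 : 1 ≤ M := by
    have : 1 ≤ ξ ^ 4 / α ^ 4 := by
      rw [le_div_iff₀ (by positivity), one_mul]; exact pow_le_pow_left₀ hα.le hαξ 4
    linarith
  set S := {q : ℤ × ℤ | q.1 ≠ 0 ∧ ∃ θ u v : ℝ, 0 < v ∧ |u| ≤ 1 / 2 ∧ 1 ≤ u ^ 2 + v ^ 2 ∧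
        (b : ℝ) = -a * (θ + 2 * u) ∧ (q.2 : ℝ) = a * (2 * θ * u + (u ^ 2 + v ^ 2)) ∧
        (q.1 : ℝ) = -a * (θ * (u ^ 2 + v ^ 2)) ∧
        4 * (a : ℝ) ^ 4 * ((θ - u) ^ 2 + v ^ 2) ^ 2 * v ^ 2 < X} with hS
  set R : ℝ := (|(b : ℝ)| + 2 * a) * M with hR
  have hR0 : 0 ≤ R := by positivity
  set D : Finset ℤ := (Finset.Icc (-⌊R⌋) ⌊R⌋).filter (· ≠ 0) with hD
  -- the `c`-fibres sit inside the sets of `ncard_cFibre_neg_le_of_small`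
  set T : ℤ → Set ℤ := fun d => {c : ℤ | ∃ θ u v : ℝ, 0 < v ∧ |u| ≤ 1 / 2 ∧ 1 ≤ u ^ 2 + v ^ 2 ∧
      u ^ 2 + v ^ 2 ≤ M ∧ (b : ℝ) = -a * (θ + 2 * u) ∧ (c : ℝ) = a * (2 * θ * u + (u ^ 2 + v ^ 2)) ∧
      (d : ℝ) = -a * (θ * (u ^ 2 + v ^ 2))} with hT
  have hpM : ∀ {θ u v : ℝ}, |u| ≤ 1 / 2 → 4 * (a : ℝ) ^ 4 * ((θ - u) ^ 2 + v ^ 2) ^ 2 * v ^ 2 < X →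
      u ^ 2 + v ^ 2 ≤ M := by
    intro θ u v hu hX
    have h1 := v_sq_lt_xi haR hX hξ hξX hα hαa
    have h2 := u_sq_le hu
    rw [hM]; linarith
  have hfib : ∀ d : ℤ, {c : ℤ | (d, c) ∈ S} ⊆ T d := by
    rintro d c ⟨-, θ, u, v, hv, hu, hp, hb', hc', hd', hX'⟩
    exact ⟨θ, u, v, hv, hu, hp, hpM hu hX', hb', hc', hd'⟩
  have hTfin : ∀ d : ℤ, (T d).Finite := by
    intro d
    refine finite_of_diam (V := 2 * |(b : ℝ)| + a + a * M) ?_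
    rintro c₁ ⟨θ₁, u₁, v₁, hv₁, hu₁, hp₁, hM₁, hb₁, hc₁, hd₁⟩ c₂ ⟨θ₂, u₂, v₂, hv₂, hu₂, hp₂, hM₂, hb₂, hc₂, hd₂⟩
    refine (abs_c_sub_c_le ha0 hu₁ hu₂ hb₁ hb₂ hc₁ hc₂).trans ?_
    have : |(u₁ ^ 2 + v₁ ^ 2) - (u₂ ^ 2 + v₂ ^ 2)| ≤ M := by
      rw [abs_le]; constructor <;> linarith
    nlinarith [this, abs_nonneg ((u₁ ^ 2 + v₁ ^ 2) - (u₂ ^ 2 + v₂ ^ 2))]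
  have hB : ∀ q ∈ S, q.1 ∈ D := by
    rintro ⟨d, c⟩ ⟨hd0, θ, u, v, hv, hu, hp, hb', hc', hd', hX'⟩
    refine mem_Icc_filter_of_abs_le hd0 ?_
    have h1 := abs_d_le (v := v) (θ := θ) haR hu
    rw [← hb', ← hd'] at h1
    refine h1.trans ?_
    rw [hR]
    exact mul_le_mul_of_nonneg_left (hpM hu hX') (by positivity)
  have hC : ∀ d ∈ D, {c : ℤ | (d, c) ∈ S}.Finite := fun d _ => (hTfin d).subset (hfib d)
  have step1 := ncard_le_sum_ncard_fibre S D hB hC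
  have step2 : ∀ d ∈ D, (({c : ℤ | (d, c) ∈ S}).ncard : ℝ) ≤ 2 * (2 * |(b : ℝ)| + a + a * M) + 1 := by
    intro d _
    calc (({c : ℤ | (d, c) ∈ S}).ncard : ℝ) ≤ ((T d).ncard : ℝ) := by
          exact_mod_cast Set.ncard_le_ncard (hfib d) (hTfin d)
      _ ≤ 2 * (2 * |(b : ℝ)| + a + a * M) + 1 := ncard_cFibre_neg_le_of_small a b d ha hM1
  have step3 : ∑ d ∈ D, (({c : ℤ | (d, c) ∈ S}).ncard : ℝ) ≤
      D.card * (2 * (2 * |(b : ℝ)| + a + a * M) + 1) := by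
    have := Finset.sum_le_sum step2
    rwa [Finset.sum_const, nsmul_eq_mul] at this
  have hDcard : (D.card : ℝ) ≤ 2 * R := card_Icc_filter_ne_zero_le hR0
  have hK0 : 0 ≤ 2 * (2 * |(b : ℝ)| + a + a * M) + 1 := by positivity
  calc (S.ncard : ℝ) ≤ D.card * (2 * (2 * |(b : ℝ)| + a + a * M) + 1) := step1.trans step3
    _ ≤ 2 * R * (2 * (2 * |(b : ℝ)| + a + a * M) + 1) := mul_le_mul_of_nonneg_right hDcard hK0
    _ ≤ 2 * (4 * a * M) * (11 * a + 2 * a * M) := by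
        apply mul_le_mul _ _ hK0 (by positivity)
        · rw [hR]; nlinarith [abs_nonneg (b : ℝ)]
        · nlinarith [abs_nonneg (b : ℝ)]
    _ = 88 * (a : ℝ) ^ 2 * M + 16 * (a : ℝ) ^ 2 * M ^ 2 := by ring

/-- **`|b| ≥ 2a`**: `#{(d, c) : (a, b, c, d) reduced, −Disc < X} ≤ 24b²M + 128a²M²` with
`M = ¼ + min(ξ⁴/α⁴, 64X/b⁴)` (`#{d} ≤ 2R`, `R = 2|b|M`, each `c`-fibre `≤ 6|b| + 16a²|d|/b²`, and
`Σ_{0<|d|≤R} |d| ≤ 2R²`). [cite: Davenport1951CubicFormsII, §3] -/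
theorem ncard_dcFibre_neg_le_of_large (a b : ℤ) (ha : 1 ≤ a) (hb : 2 * (a : ℝ) ≤ |(b : ℝ)|)
    {X ξ α : ℝ} (hξ : 0 < ξ) (hξX : ξ ^ 12 = X) (hα : 0 < α) (hαa : α ^ 3 = a) :
    (({q : ℤ × ℤ | q.1 ≠ 0 ∧ ∃ θ u v : ℝ, 0 < v ∧ |u| ≤ 1 / 2 ∧ 1 ≤ u ^ 2 + v ^ 2 ∧
        (b : ℝ) = -a * (θ + 2 * u) ∧ (q.2 : ℝ) = a * (2 * θ * u + (u ^ 2 + v ^ 2)) ∧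
        (q.1 : ℝ) = -a * (θ * (u ^ 2 + v ^ 2)) ∧
        4 * (a : ℝ) ^ 4 * ((θ - u) ^ 2 + v ^ 2) ^ 2 * v ^ 2 < X}).ncard : ℝ) ≤
      24 * (b : ℝ) ^ 2 * (1 / 4 + min (ξ ^ 4 / α ^ 4) (64 * X / (b : ℝ) ^ 4)) +
        128 * (a : ℝ) ^ 2 * (1 / 4 + min (ξ ^ 4 / α ^ 4) (64 * X / (b : ℝ) ^ 4)) ^ 2 := by
  classical
  set M : ℝ := 1 / 4 + min (ξ ^ 4 / α ^ 4) (64 * X / (b : ℝ) ^ 4) with hM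
  have haR : (1 : ℝ) ≤ a := by exact_mod_cast ha
  have ha0 : (0 : ℝ) < a := by linarith
  have hb0 : 0 < |(b : ℝ)| := by linarith
  have hb2 : 0 < (b : ℝ) ^ 2 := by rw [← sq_abs]; exact pow_pos hb0 2
  have hX0 : 0 ≤ X := by rw [← hξX]; positivity
  have hM0 : 0 ≤ M := by
    have : 0 ≤ min (ξ ^ 4 / α ^ 4) (64 * X / (b : ℝ) ^ 4) :=
      le_min (by positivity) (by positivity)
    rw [hM]; linarith
  set S := {q : ℤ × ℤ | q.1 ≠ 0 ∧ ∃ θ u v : ℝ, 0 < v ∧ |u| ≤ 1 / 2 ∧ 1 ≤ u ^ 2 + v ^ 2 ∧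
        (b : ℝ) = -a * (θ + 2 * u) ∧ (q.2 : ℝ) = a * (2 * θ * u + (u ^ 2 + v ^ 2)) ∧
        (q.1 : ℝ) = -a * (θ * (u ^ 2 + v ^ 2)) ∧
        4 * (a : ℝ) ^ 4 * ((θ - u) ^ 2 + v ^ 2) ^ 2 * v ^ 2 < X} with hS
  set R : ℝ := 2 * |(b : ℝ)| * M with hR
  have hR0 : 0 ≤ R := by positivity
  set D : Finset ℤ := (Finset.Icc (-⌊R⌋) ⌊R⌋).filter (· ≠ 0) with hD
  set T : ℤ → Set ℤ := fun d => {c : ℤ | ∃ θ u v : ℝ, 0 < v ∧ |u| ≤ 1 / 2 ∧ 1 ≤ u ^ 2 + v ^ 2 ∧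
      (b : ℝ) = -a * (θ + 2 * u) ∧ (c : ℝ) = a * (2 * θ * u + (u ^ 2 + v ^ 2)) ∧
      (d : ℝ) = -a * (θ * (u ^ 2 + v ^ 2))} with hT
  have hpM : ∀ {θ u v : ℝ}, |u| ≤ 1 / 2 → (b : ℝ) = -a * (θ + 2 * u) →
      4 * (a : ℝ) ^ 4 * ((θ - u) ^ 2 + v ^ 2) ^ 2 * v ^ 2 < X → u ^ 2 + v ^ 2 ≤ M := by
    intro θ u v hu hb' hX
    have h1 := v_sq_lt_xi haR hX hξ hξX hα hαa
    have h2 := u_sq_le hu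
    have h3 : v ^ 2 < 64 * X / (b : ℝ) ^ 4 := by
      have := v_sq_lt_of_large (v := v) haR hu hX (by rw [← hb']; exact hb)
      rwa [← hb'] at this
    have : v ^ 2 ≤ min (ξ ^ 4 / α ^ 4) (64 * X / (b : ℝ) ^ 4) := le_min h1.le h3.le
    rw [hM]; linarith
  have hfib : ∀ d : ℤ, {c : ℤ | (d, c) ∈ S} ⊆ T d := by
    rintro d c ⟨-, θ, u, v, hv, hu, hp, hb', hc', hd', -⟩
    exact ⟨θ, u, v, hv, hu, hp, hb', hc', hd'⟩
  have hTfin : ∀ d : ℤ, (T d).Finite := by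
    intro d
    refine finite_of_diam (V := 2 * |(b : ℝ)| + a + 8 * (a : ℝ) ^ 2 * |(d : ℝ)| / (b : ℝ) ^ 2) ?_
    rintro c₁ ⟨θ₁, u₁, v₁, hv₁, hu₁, hp₁, hb₁, hc₁, hd₁⟩ c₂ ⟨θ₂, u₂, v₂, hv₂, hu₂, hp₂, hb₂, hc₂, hd₂⟩
    refine (abs_c_sub_c_le ha0 hu₁ hu₂ hb₁ hb₂ hc₁ hc₂).trans ?_
    have := a_mul_abs_p_sub_p_le ha0 hb hu₁ hu₂ hb₁ hb₂ hd₁ hd₂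
    linarith
  have hB : ∀ q ∈ S, q.1 ∈ D := by
    rintro ⟨d, c⟩ ⟨hd0, θ, u, v, hv, hu, hp, hb', hc', hd', hX'⟩
    refine mem_Icc_filter_of_abs_le hd0 ?_
    have h1 := abs_d_le (v := v) (θ := θ) haR hu
    rw [← hb', ← hd'] at h1
    refine h1.trans ?_
    rw [hR]
    have hp0 : 0 ≤ u ^ 2 + v ^ 2 := by positivity
    calc (|(b : ℝ)| + 2 * a) * (u ^ 2 + v ^ 2) ≤ (2 * |(b : ℝ)|) * (u ^ 2 + v ^ 2) :=
          mul_le_mul_of_nonneg_right (by linarith) hp0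
      _ ≤ 2 * |(b : ℝ)| * M := mul_le_mul_of_nonneg_left (hpM hu hb' hX') (by positivity)
  have hC : ∀ d ∈ D, {c : ℤ | (d, c) ∈ S}.Finite := fun d _ => (hTfin d).subset (hfib d)
  have step1 := ncard_le_sum_ncard_fibre S D hB hC
  -- per-`d` bound `≤ 6|b| + 16 a² |d| / b²`
  have step2 : ∀ d ∈ D, (({c : ℤ | (d, c) ∈ S}).ncard : ℝ) ≤
      6 * |(b : ℝ)| + 16 * (a : ℝ) ^ 2 / (b : ℝ) ^ 2 * |(d : ℝ)| := by
    intro d _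
    calc (({c : ℤ | (d, c) ∈ S}).ncard : ℝ) ≤ ((T d).ncard : ℝ) := by
          exact_mod_cast Set.ncard_le_ncard (hfib d) (hTfin d)
      _ ≤ 2 * (2 * |(b : ℝ)| + a + 8 * (a : ℝ) ^ 2 * |(d : ℝ)| / (b : ℝ) ^ 2) + 1 :=
          ncard_cFibre_neg_le_of_large a b d ha hb
      _ = (4 * |(b : ℝ)| + 2 * a + 1) + 16 * (a : ℝ) ^ 2 / (b : ℝ) ^ 2 * |(d : ℝ)| := by ring
      _ ≤ 6 * |(b : ℝ)| + 16 * (a : ℝ) ^ 2 / (b : ℝ) ^ 2 * |(d : ℝ)| := by linarith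
  have step3 : ∑ d ∈ D, (({c : ℤ | (d, c) ∈ S}).ncard : ℝ) ≤
      ∑ d ∈ D, (6 * |(b : ℝ)| + 16 * (a : ℝ) ^ 2 / (b : ℝ) ^ 2 * |(d : ℝ)|) := Finset.sum_le_sum step2
  have hDcard : (D.card : ℝ) ≤ 2 * R := card_Icc_filter_ne_zero_le hR0
  have hsumd : ∑ d ∈ D, |(d : ℝ)| ≤ 2 * R * R := by
    have h1 : ∀ d ∈ D, |(d : ℝ)| ≤ R := fun d hd => abs_le_of_mem_Icc_filter hd
    calc ∑ d ∈ D, |(d : ℝ)| ≤ ∑ d ∈ D, R := Finset.sum_le_sum h1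
      _ = D.card * R := by rw [Finset.sum_const, nsmul_eq_mul]
      _ ≤ 2 * R * R := mul_le_mul_of_nonneg_right hDcard hR0
  have step4 : ∑ d ∈ D, (6 * |(b : ℝ)| + 16 * (a : ℝ) ^ 2 / (b : ℝ) ^ 2 * |(d : ℝ)|) ≤
      2 * R * (6 * |(b : ℝ)|) + 16 * (a : ℝ) ^ 2 / (b : ℝ) ^ 2 * (2 * R * R) := by
    rw [Finset.sum_add_distrib, Finset.sum_const, nsmul_eq_mul, ← Finset.mul_sum]
    have h16 : 0 ≤ 16 * (a : ℝ) ^ 2 / (b : ℝ) ^ 2 := by positivity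
    nlinarith [mul_le_mul_of_nonneg_left hsumd h16, mul_le_mul_of_nonneg_right hDcard
      (by positivity : (0 : ℝ) ≤ 6 * |(b : ℝ)|)]
  have hfinal : 2 * R * (6 * |(b : ℝ)|) + 16 * (a : ℝ) ^ 2 / (b : ℝ) ^ 2 * (2 * R * R) =
      24 * (b : ℝ) ^ 2 * M + 128 * (a : ℝ) ^ 2 * M ^ 2 := by
    have hbb : (b : ℝ) ^ 2 = |(b : ℝ)| ^ 2 := (sq_abs _).symm
    have hbne : |(b : ℝ)| ≠ 0 := hb0.ne'
    rw [hR, hbb]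
    field_simp
    ring
  linarith [step1, step3, step4, hfinal.le]

/-- The `(d, c)`-set for fixed `(a, b)` is finite (`|d| ≤ (|b| + 2a)M`, `|c| ≤ |b| + a + aM`,
`M = ¼ + ξ⁴/α⁴`). [folklore] -/
theorem dcFibre_neg_finite (a b : ℤ) (ha : 1 ≤ a)
    {X ξ α : ℝ} (hξ : 0 < ξ) (hξX : ξ ^ 12 = X) (hα : 0 < α) (hαa : α ^ 3 = a) :
    ({q : ℤ × ℤ | q.1 ≠ 0 ∧ ∃ θ u v : ℝ, 0 < v ∧ |u| ≤ 1 / 2 ∧ 1 ≤ u ^ 2 + v ^ 2 ∧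
        (b : ℝ) = -a * (θ + 2 * u) ∧ (q.2 : ℝ) = a * (2 * θ * u + (u ^ 2 + v ^ 2)) ∧
        (q.1 : ℝ) = -a * (θ * (u ^ 2 + v ^ 2)) ∧
        4 * (a : ℝ) ^ 4 * ((θ - u) ^ 2 + v ^ 2) ^ 2 * v ^ 2 < X}).Finite := by
  set M : ℝ := 1 / 4 + ξ ^ 4 / α ^ 4 with hM
  have haR : (1 : ℝ) ≤ a := by exact_mod_cast ha
  have ha0 : (0 : ℝ) < a := by linarith
  set R : ℝ := (|(b : ℝ)| + 2 * a) * M with hR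
  set C : ℝ := |(b : ℝ)| + a + a * M with hC
  have hsub : {q : ℤ × ℤ | q.1 ≠ 0 ∧ ∃ θ u v : ℝ, 0 < v ∧ |u| ≤ 1 / 2 ∧ 1 ≤ u ^ 2 + v ^ 2 ∧
        (b : ℝ) = -a * (θ + 2 * u) ∧ (q.2 : ℝ) = a * (2 * θ * u + (u ^ 2 + v ^ 2)) ∧
        (q.1 : ℝ) = -a * (θ * (u ^ 2 + v ^ 2)) ∧
        4 * (a : ℝ) ^ 4 * ((θ - u) ^ 2 + v ^ 2) ^ 2 * v ^ 2 < X} ⊆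
      {d : ℤ | -R ≤ d ∧ (d : ℝ) ≤ R} ×ˢ {c : ℤ | -C ≤ c ∧ (c : ℝ) ≤ C} := by
    rintro ⟨d, c⟩ ⟨-, θ, u, v, hv, hu, hp, hb', hc', hd', hX'⟩
    have hpM : u ^ 2 + v ^ 2 ≤ M := by
      have h1 := v_sq_lt_xi haR hX' hξ hξX hα hαa
      have h2 := u_sq_le hu
      rw [hM]; linarith
    have hp0 : 0 ≤ u ^ 2 + v ^ 2 := by positivity
    have hdR : |(d : ℝ)| ≤ R := by
      have h1 := abs_d_le (v := v) (θ := θ) haR hu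
      rw [← hb', ← hd'] at h1
      exact h1.trans (mul_le_mul_of_nonneg_left hpM (by positivity))
    have hcC : |(c : ℝ)| ≤ C := by
      have hθ : (a : ℝ) * |θ| ≤ |(b : ℝ)| + a := by
        have e : (a : ℝ) * θ = -(b : ℝ) - 2 * a * u := by rw [hb']; ring
        have h1 : (a : ℝ) * |θ| = |(a : ℝ) * θ| := by rw [abs_mul, abs_of_pos ha0]
        rw [h1, e]
        refine (abs_sub _ _).trans ?_
        rw [abs_neg, abs_mul, abs_of_pos (by positivity : (0 : ℝ) < 2 * a)]
        nlinarith [abs_nonneg u]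
      rw [hc', abs_mul, abs_of_pos ha0, hC]
      have hu1 := abs_le.mp hu
      calc (a : ℝ) * |2 * θ * u + (u ^ 2 + v ^ 2)| ≤ (a : ℝ) * (|θ| + (u ^ 2 + v ^ 2)) := by
            apply mul_le_mul_of_nonneg_left _ ha0.le
            refine (abs_add_le _ _).trans ?_
            rw [abs_of_nonneg hp0]
            have : |2 * θ * u| ≤ |θ| := by
              rw [show 2 * θ * u = θ * (2 * u) by ring, abs_mul]
              have : |2 * u| ≤ 1 := by rw [abs_le]; constructor <;> linarith
              nlinarith [abs_nonneg θ]
            linarith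
        _ ≤ |(b : ℝ)| + a + a * M := by nlinarith [mul_le_mul_of_nonneg_left hpM ha0.le]
    simp only [Set.mem_prod, Set.mem_setOf_eq]
    exact ⟨⟨by linarith [(abs_le.mp hdR).1], (abs_le.mp hdR).2⟩,
      ⟨by linarith [(abs_le.mp hcC).1], (abs_le.mp hcC).2⟩⟩
  refine Set.Finite.subset (Set.Finite.prod ?_ ?_) hsub
  · rw [int_mem_Icc_eq]; exact Finset.finite_toSet _
  · rw [int_mem_Icc_eq]; exact Finset.finite_toSet _

end BinaryCubic


end Literature.NumberTheory.CubicFields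

end
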